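import Mathlib
import Literature.Analysis.FluidPDE.ChaeAsymptoticallySelfSimilarWeakLimit
import Literature.Analysis.FluidPDE.SuitableWeak
import Summits.NavierStokesRegularity.NavierStokesRegularity.Theorems.LandauTailLandauTailBlowupVitaliLp
import Summits.NavierStokesRegularity.NavierStokesRegularity.Theorems.LandauTailLandauTailBlowupWeakLimit
import Summits.NavierStokesRegularity.NavierStokesRegularity.Theorems.LandauTailLandauTailBlowupDefectPointwise

/-!
# Crux `LandauTail.LandauTailBlowup` (stmt-NavierStokesRegularity-1944), line `registered`, cycle c6:
  stub `landauTail_veryWeak_defect_le` — the defect inequality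

Helper file on the proof path of the crux item `stmt-NavierStokesRegularity-1944`
(`Summit.NavierStokesRegularity.NavierStokesRegularity.Theses.LandauTail.LandauTailBlowup`), lead c6: the
registered support stub `landauTail_veryWeak_defect_le` (A4), heart of the cycle's quantitative flux theorem at the
energy level (the scaled `L²`-defect floor `landauTail_defect_floor_engine`). In the very weak, pressure-free
formulation (KNSS 2009 §4 (ii); along blow-up rescalings as in Chae 2007, proof of Thm 1.5, p. 8), for a test `ψ`
supported in `S = (s₁,s₂) × B_ρ ⊆ Q₁`, fields `u n` with `∫∫ F(u n) = 0`, a steady `U ∈ L^{5/2}(B₁)` and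
`w n = u n − U` BOUNDED in `L²(S)` with `w n → 0` a.e. on `S`, the pointwise split of
`LandauTailLandauTailBlowupDefectPointwise` gives `|F(u n) − F(U)| ≤ 2M₀|w| + 2M₀|U||w| + M|w|²` (`M = sup‖∇ψ‖`);
Vitali from the `L²(S)` bound (`landauTail_tendsto_eLpNorm_of_eLpNorm_le`, exponents `1` and `5/3`) and Hölder
`(5/2, 5/3)` against `U` kill the linear terms, whence `‖∫∫ F(U)‖ ≤ M · liminf_n ∫∫_S |u n − U|²`. In the
application `∫∫F(U) = −(∫θ) β(A) ≠ 0` is Landau's point momentum flux, so the scaled `L²`-defect cannot vanish.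

References: Chae 2007 (Math. Ann. 338) p. 8; KNSS 2009 (Acta Math. 203) §4 (ii); P.-L. Lions, *Mathematical
Topics in Fluid Mechanics* I (1996), §1.4 (defects of weakly convergent quadratic terms) [folklore technique].
-/

set_option linter.dupNamespace false

noncomputable section

open MeasureTheory Set Function Filter Metric TopologicalSpace InnerProductSpace
open scoped NNReal ENNReal Topology RealInnerProductSpace Laplacian ContDiff
open Literature.Analysis.FluidPDE

namespace Summit.NavierStokesRegularity.NavierStokesRegularity.Theorems


/-- **The defect inequality** (registered support stub A4 of crux stmt-NavierStokesRegularity-1944, lead c6; the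
heart of the quantitative flux theorem). Let the fields `u n` be continuous on the slab `(−1,0) × ℝ³` and satisfy
the very weak Navier–Stokes identity (`ν = 1`) against a test field `ψ` of the unit parabolic cylinder whose support
lies in `S = (s₁,s₂) × B_ρ`, `−1 ≤ s₁ < s₂ ≤ 0`, `0 < ρ ≤ 1`, with `‖∇ψ‖ ≤ M`; let `U ∈ L^{5/2}(B₁)` be measurable,
`‖u n − U‖_{L²(S)} ≤ C` for all `n` and `u n → U` a.e. on `S`. Then
`‖∫∫ F(U)‖ₑ ≤ M · liminf_n ∫∫_S |u n − U|²`: in the split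
`F(u n) − F(U) = linear(u n − U) + ⟪u n − U, (∇ψ)(u n − U)⟫` the linear part tends to `0` in `L¹`
(Vitali at exponents `1` and `5/3` from the `L²(S)` bound, Hölder `(5/2, 5/3)` against `U`), and the quadratic
defect is at most `M |u n − U|²` pointwise (Chae 2007 p. 8 and KNSS 2009 §4 (ii) for the formulation; P.-L. Lions
1996 §1.4 for defects of quadratic terms). [folklore] -/
theorem landauTail_veryWeak_defect_le : ∀ (u : ℕ → ℝ → EuclideanSpace ℝ (Fin 3) → EuclideanSpace ℝ (Fin 3)) (U : EuclideanSpace ℝ (Fin 3) → EuclideanSpace ℝ (Fin 3)) (ψ : ℝ → EuclideanSpace ℝ (Fin 3) → EuclideanSpace ℝ (Fin 3)) (s₁ s₂ ρ M : ℝ) (C : NNReal), -1 ≤ s₁ → s₁ < s₂ → s₂ ≤ 0 → 0 < ρ → ρ ≤ 1 → (∀ n, ContinuousOn (Function.uncurry (u n)) (Set.Ioo (-1 : ℝ) 0 ×ˢ Set.univ)) → Literature.Analysis.FluidPDE.IsSpaceTimeTestOn (Literature.Analysis.FluidPDE.parabolicCylinderOpens 1 ((0 : ℝ), (0 : EuclideanSpace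 ℝ (Fin 3)))) ψ → tsupport (Function.uncurry ψ) ⊆ Set.Ioo s₁ s₂ ×ˢ Metric.ball (0 : EuclideanSpace ℝ (Fin 3)) ρ → (∀ t x, ‖fderiv ℝ (ψ t) x‖ ≤ M) → (∀ n, ∫ t in Set.Ioo (-1 : ℝ) 0, ∫ x, (inner ℝ (u n t x) (Literature.Analysis.FluidPDE.timeDeriv ψ t x) + inner ℝ (u n t x) (Literature.Analysis.FluidPDE.convect (u n t) (ψ t) x) + 1 * inner ℝ (u n t x) (Laplacian.laplacian (ψ t) x)) = 0) → MeasureTheory.AEStronglyMeasurable U MeasureTheory.volume → MeasureTheory.eLpNorm U (5 / 2) (MeasureTheory.volume.restrict (Metric.ball (0 : EuclideanSpace ℝ (Fin 3)) 1)) < ⊤ → (∀ n, MeasureTheory.eLpNorm (fun z : ℝ × EuclideanSpace ℝ (Fin 3) => u n z.1 z.2 - U z.2) 2 (MeasureTheory.volume.restrict (Set.Ioo s₁ s₂ ×ˢ Metric.ball (0 : EuclideanSpace ℝ (Fin 3)) ρ)) ≤ C) → (∀ᵐ z ∂(MeasureTheory.volume.restrict (Set.Ioo s₁ s₂ ×ˢ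 Metric.ball (0 : EuclideanSpace ℝ (Fin 3)) ρ)), Filter.Tendsto (fun n => u n z.1 z.2) Filter.atTop (nhds (U z.2))) → ‖∫ t in Set.Ioo (-1 : ℝ) 0, ∫ x, (inner ℝ (U x) (Literature.Analysis.FluidPDE.timeDeriv ψ t x) + inner ℝ (U x) (Literature.Analysis.FluidPDE.convect U (ψ t) x) + 1 * inner ℝ (U x) (Laplacian.laplacian (ψ t) x))‖ₑ ≤ ENNReal.ofReal M * Filter.liminf (fun n => ∫⁻ z in Set.Ioo s₁ s₂ ×ˢ Metric.ball (0 : EuclideanSpace ℝ (Fin 3)) ρ, ‖u n z.1 z.2 - U z.2‖ₑ ^ 2) Filter.atTop := by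
  intro u U ψ s₁ s₂ ρ M C hs₁ hs₁₂ hs₂ hρ hρ1 huc hψ hS hMD hid hUm hU52 hbd hae
  -- notation
  set S : Set (ℝ × (EuclideanSpace ℝ (Fin 3))) := Ioo s₁ s₂ ×ˢ ball (0 : (EuclideanSpace ℝ (Fin 3))) ρ with hSdef
  have hSm : MeasurableSet S := measurableSet_Ioo.prod measurableSet_ball
  have hSslab : S ⊆ Ioo (-1 : ℝ) 0 ×ˢ (univ : Set (EuclideanSpace ℝ (Fin 3))) := by
    rintro ⟨t, x⟩ ⟨⟨ht1, ht2⟩, -⟩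
    exact ⟨⟨lt_of_lt_of_le' ht1 hs₁, lt_of_lt_of_le ht2 hs₂⟩, mem_univ _⟩
  set μS : Measure (ℝ × (EuclideanSpace ℝ (Fin 3))) := volume.restrict S with hμS
  haveI hμSfin : IsFiniteMeasure μS := by
    refine ⟨?_⟩
    rw [hμS, Measure.restrict_apply_univ, hSdef, Measure.volume_eq_prod, Measure.prod_prod, Real.volume_Ioo]
    exact ENNReal.mul_lt_top ENNReal.ofReal_lt_top measure_ball_lt_top
  -- the very weak integrand (`ν = 1`); `U` enters as the time-independent field `fun _ => U`
  set Fn : (ℝ → (EuclideanSpace ℝ (Fin 3)) → (EuclideanSpace ℝ (Fin 3))) → ℝ → (EuclideanSpace ℝ (Fin 3)) → ℝ := fun v t x =>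
    ⟪v t x, timeDeriv ψ t x⟫ + ⟪v t x, fderiv ℝ (ψ t) x (v t x)⟫ + 1 * ⟪v t x, Δ (ψ t) x⟫
    with hFn
  have hid' : ∀ n, ∫ t in Ioo (-1 : ℝ) 0, ∫ x, Fn (u n) t x = 0 := hid
  show ‖∫ t in Ioo (-1 : ℝ) 0, ∫ x, Fn (fun _ => U) t x‖ₑ ≤
    ENNReal.ofReal M * liminf (fun n => ∫⁻ z in S, ‖u n z.1 z.2 - U z.2‖ₑ ^ 2) atTop
  -- the deviations
  set w : ℕ → ℝ × (EuclideanSpace ℝ (Fin 3)) → (EuclideanSpace ℝ (Fin 3)) := fun n z => u n z.1 z.2 - U z.2 with hw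
  set D : ℕ → ℝ≥0∞ := fun n => ∫⁻ z in S, ‖w n z‖ₑ ^ 2 with hD
  show ‖∫ t in Ioo (-1 : ℝ) 0, ∫ x, Fn (fun _ => U) t x‖ₑ ≤ ENNReal.ofReal M * liminf D atTop
  -- Step 0: the support of the test field and a compact time window inside `(-1, 0)`
  have hQ : ∀ z : ℝ × (EuclideanSpace ℝ (Fin 3)), z ∈ (parabolicCylinderOpens 1 ((0 : ℝ), (0 : (EuclideanSpace ℝ (Fin 3)))) : Set (ℝ × (EuclideanSpace ℝ (Fin 3)))) →
      z.1 ∈ Ioo (-1 : ℝ) 0 ∧ z.2 ∈ ball (0 : (EuclideanSpace ℝ (Fin 3))) 1 := by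
    intro z hz
    rw [coe_parabolicCylinderOpens, mem_parabolicCylinder] at hz
    obtain ⟨⟨h1, h2⟩, h3⟩ := hz
    exact ⟨⟨by linarith, by simpa using h2⟩, by simpa [mem_ball] using h3⟩
  have hψ' : IsSpaceTimeTestOn (slab (EuclideanSpace ℝ (Fin 3)) (Ioo (-1 : ℝ) 0) isOpen_Ioo) ψ :=
    hψ.mono fun z hz => mem_slab.2 (hQ z hz).1
  obtain ⟨a', b', ha', -, hb', hsupp⟩ := hψ'.exists_time_support_Ioo (by norm_num)
  set a₁ : ℝ := (-1 + a') / 2 with ha₁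
  set b₁ : ℝ := b' / 2 with hb₁
  have h1a₁ : -1 < a₁ := by rw [ha₁]; linarith
  have ha₁a' : a₁ < a' := by rw [ha₁]; linarith
  have hb'b₁ : b' < b₁ := by rw [hb₁]; linarith
  have hb₁0 : b₁ < 0 := by rw [hb₁]; linarith
  have hIcc : Icc a₁ b₁ ⊆ Ioo (-1) 0 := fun t ht => ⟨h1a₁.trans_le ht.1, ht.2.trans_lt hb₁0⟩
  have hIoo : Ioo a₁ b₁ ⊆ Ioo (-1) 0 := Ioo_subset_Icc_self.trans hIcc
  obtain ⟨M₀, -, hM₀⟩ := hψ.exists_uniform_bound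
  have hMt : ∀ t x, ‖timeDeriv ψ t x‖ ≤ M₀ ∧ ‖fderiv ℝ (ψ t) x‖ ≤ M₀ ∧ ‖Δ (ψ t) x‖ ≤ M₀ := hM₀
  -- the derived test data vanish off `S` (hence off `ball 0 1` in space) and off `[a', b']` in time
  have hzero_S : ∀ t x, (t, x) ∉ S →
      timeDeriv ψ t x = 0 ∧ fderiv ℝ (ψ t) x = 0 ∧ Δ (ψ t) x = 0 := fun t x hz =>
    derived_eq_zero_of_notMem_tsupport fun h => hz (hS h)
  have hzero_x : ∀ t, ∀ x ∉ ball (0 : (EuclideanSpace ℝ (Fin 3))) 1,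
      timeDeriv ψ t x = 0 ∧ fderiv ℝ (ψ t) x = 0 ∧ Δ (ψ t) x = 0 := by
    intro t x hx
    refine hzero_S t x fun hz => hx ?_
    exact ball_subset_ball hρ1 hz.2
  have hzero_t : ∀ t, t ∉ Icc a' b' → ∀ x,
      timeDeriv ψ t x = 0 ∧ fderiv ℝ (ψ t) x = 0 ∧ Δ (ψ t) x = 0 := by
    intro t ht x
    refine derived_eq_zero_of_notMem_tsupport (notMem_tsupport_iff_eventuallyEq.2 ?_)
    have hopen : IsOpen ((Icc a' b')ᶜ ×ˢ (univ : Set (EuclideanSpace ℝ (Fin 3)))) :=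
      isClosed_Icc.isOpen_compl.prod isOpen_univ
    filter_upwards [hopen.mem_nhds (mk_mem_prod ht (mem_univ x))] with z hz
    have hz1 : z.1 ∉ Icc a' b' := hz.1
    simp only [uncurry, hsupp z.1 hz1, Pi.zero_apply]
  have hFn0_t : ∀ v t, t ∉ Icc a' b' → ∀ x, Fn v t x = 0 := by
    intro v t ht x
    obtain ⟨h1, h2, h3⟩ := hzero_t t ht x
    simp only [hFn, h1, h2, h3, inner_zero_right, zero_apply, mul_zero, add_zero]
  have hFn0_S : ∀ v t x, (t, x) ∉ S → Fn v t x = 0 := by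
    intro v t x hz
    obtain ⟨h1, h2, h3⟩ := hzero_S t x hz
    simp only [hFn, h1, h2, h3, inner_zero_right, zero_apply, mul_zero, add_zero]
  have hFn0_x : ∀ v t, ∀ x ∉ ball (0 : (EuclideanSpace ℝ (Fin 3))) 1, Fn v t x = 0 := by
    intro v t x hx
    obtain ⟨h1, h2, h3⟩ := hzero_x t x hx
    simp only [hFn, h1, h2, h3, inner_zero_right, zero_apply, mul_zero, add_zero]
  -- reduction of the time integral to `(a₁, b₁)`
  have hreduce : ∀ v, ∫ t in Ioo (-1 : ℝ) 0, ∫ x, Fn v t x = ∫ t in Ioo a₁ b₁, ∫ x, Fn v t x := by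
    intro v
    refine setIntegral_eq_of_subset_of_forall_sdiff_eq_zero measurableSet_Ioo hIoo fun t ht => ?_
    have ht' : t ∉ Icc a' b' := fun h' => ht.2 ⟨ha₁a'.trans_le h'.1, h'.2.trans_lt hb'b₁⟩
    simp only [hFn0_t v t ht', integral_zero]
  rw [hreduce]
  simp only [hreduce] at hid'
  -- Step 1: the test data are continuous; slices of the limit integrand are integrable
  have hU2 : eLpNorm U 2 (volume.restrict (ball (0 : (EuclideanSpace ℝ (Fin 3))) 1)) < ⊤ := by
    have h52 : (2 : ℝ≥0∞) ≤ 5 / 2 := by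
      rw [show (5 / 2 : ℝ≥0∞) = ENNReal.ofReal (5 / 2) by
        rw [ENNReal.ofReal_div_of_pos (by norm_num)]; simp,
        show (2 : ℝ≥0∞) = ENNReal.ofReal 2 by simp]
      exact ENNReal.ofReal_le_ofReal (by norm_num)
    haveI : IsFiniteMeasure (volume.restrict (ball (0 : (EuclideanSpace ℝ (Fin 3))) 1)) := ⟨by
      rw [Measure.restrict_apply_univ]; exact measure_ball_lt_top⟩
    refine lt_of_le_of_lt (eLpNorm_le_eLpNorm_mul_rpow_measure_univ h52 hUm.restrict) ?_
    refine ENNReal.mul_lt_top hU52 (ENNReal.rpow_lt_top_of_nonneg ?_ (measure_ne_top _ _))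
    rw [sub_nonneg]
    refine one_div_le_one_div_of_le (by norm_num) ?_
    have : (5 / 2 : ℝ≥0∞).toReal = 5 / 2 := by
      rw [ENNReal.toReal_div]; simp
    rw [this]; norm_num
  set NU : ℝ≥0∞ := eLpNorm U 2 (volume.restrict (ball (0 : (EuclideanSpace ℝ (Fin 3))) 1)) with hNU
  have hNUtop : NU ≠ ⊤ := hU2.ne
  set K₁ : ℝ≥0∞ := ENNReal.ofReal (1 + |(1 : ℝ)|) * volume (ball (0 : (EuclideanSpace ℝ (Fin 3))) 1) ^ (1 / 2 : ℝ) with hK₁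
  have hK₁top : K₁ ≠ ⊤ := ENNReal.mul_ne_top ENNReal.ofReal_ne_top
    (ENNReal.rpow_ne_top_of_nonneg (by norm_num) measure_ball_lt_top.ne)
  have hBU : ENNReal.ofReal M₀ * NU * (K₁ + NU) ≠ ⊤ :=
    ENNReal.mul_ne_top (ENNReal.mul_ne_top ENNReal.ofReal_ne_top hNUtop)
      (ENNReal.add_ne_top.2 ⟨hK₁top, hNUtop⟩)
  have c1 : Continuous (uncurry (timeDeriv ψ)) := hψ.continuous_timeDeriv
  have c2 : Continuous fun z : ℝ × (EuclideanSpace ℝ (Fin 3)) => fderiv ℝ (ψ z.1) z.2 := by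
    have := ((hψ.isSmoothSpaceTimeOn univ).fderiv_slice uniqueDiffOn_univ).continuousOn
    rwa [univ_prod_univ, continuousOn_univ] at this
  have c3 : Continuous fun z : ℝ × (EuclideanSpace ℝ (Fin 3)) => Δ (ψ z.1) z.2 := by
    have := ((hψ.isSmoothSpaceTimeOn univ).laplacian uniqueDiffOn_univ).continuousOn
    rwa [univ_prod_univ, continuousOn_univ] at this
  have cd : ∀ t, Continuous (timeDeriv ψ t) := fun t => c1.comp (Continuous.prodMk_right t)
  have cD : ∀ t, Continuous fun x => fderiv ℝ (ψ t) x := fun t =>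
    c2.comp (Continuous.prodMk_right t)
  have cL : ∀ t, Continuous fun x => Δ (ψ t) x := fun t =>
    continuous_laplacian (contDiff_infty.1 (hψ.contDiff_slice t) 2)
  have hU_lint : ∀ t, ∫⁻ x, ‖Fn (fun _ => U) t x‖ₑ ≤ ENNReal.ofReal M₀ * NU * (K₁ + NU) := fun t =>
    lintegral_veryWeakIntegrand_le (ν := 1) (hMt t) (hzero_x t) hUm
  have hintU : ∀ t, Integrable (Fn (fun _ => U) t) volume := fun t =>
    ⟨aestronglyMeasurable_veryWeakIntegrand hUm (cd t) (cD t) (cL t),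
      hasFiniteIntegral_iff_enorm.2 ((hU_lint t).trans_lt hBU.lt_top)⟩
  have hU_prod : Integrable (fun z : ℝ × (EuclideanSpace ℝ (Fin 3)) => Fn (fun _ => U) z.1 z.2)
      ((volume.restrict (Ioo a₁ b₁)).prod volume) := by
    have hm : AEStronglyMeasurable (fun z : ℝ × (EuclideanSpace ℝ (Fin 3)) => Fn (fun _ => U) z.1 z.2)
        ((volume.restrict (Ioo a₁ b₁)).prod volume) :=
      landauTail_aestronglyMeasurable_integrand (ν := 1) hUm.comp_snd c1.aestronglyMeasurable
        c2.aestronglyMeasurable c3.aestronglyMeasurable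
    refine ⟨hm, ?_⟩
    rw [hasFiniteIntegral_iff_enorm, lintegral_prod _ hm.enorm]
    refine lt_of_le_of_lt (lintegral_mono fun t => hU_lint t) ?_
    rw [lintegral_const, Measure.restrict_apply_univ, Real.volume_Ioo]
    exact ENNReal.mul_lt_top hBU.lt_top ENNReal.ofReal_lt_top
  have hFU_int : Integrable (fun t => ∫ x, Fn (fun _ => U) t x) (volume.restrict (Ioo a₁ b₁)) :=
    hU_prod.integral_prod_left
  -- Step 2: the approximants: continuity on the closed window, integrability of slices and in time
  have hGcont : ∀ n, ContinuousOn (fun z : ℝ × (EuclideanSpace ℝ (Fin 3)) => Fn (u n) z.1 z.2) (Icc a₁ b₁ ×ˢ univ) := by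
    intro n
    have hu : ContinuousOn (uncurry (u n)) (Icc a₁ b₁ ×ˢ univ) :=
      (huc n).mono (prod_mono hIcc Subset.rfl)
    exact ((hu.inner c1.continuousOn).add (hu.inner (c2.continuousOn.clm_apply hu))).add
      (continuousOn_const.mul (hu.inner c3.continuousOn))
  have hGzero : ∀ v, ∀ t ∈ Icc a₁ b₁, ∀ x ∉ closedBall (0 : (EuclideanSpace ℝ (Fin 3))) 1,
      (fun z : ℝ × (EuclideanSpace ℝ (Fin 3)) => Fn v z.1 z.2) (t, x) = 0 := fun v t _ x hx =>
    hFn0_x v t x fun h => hx (ball_subset_closedBall h)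
  have hslice_cont : ∀ n, ∀ t ∈ Ioo a₁ b₁,
      Continuous (u n t) ∧ Continuous fun x => Fn (u n) t x := by
    intro n t ht
    have hmaps : ∀ x ∈ (univ : Set (EuclideanSpace ℝ (Fin 3))), (t, x) ∈ Icc a₁ b₁ ×ˢ (univ : Set (EuclideanSpace ℝ (Fin 3))) := fun x _ =>
      mk_mem_prod (Ioo_subset_Icc_self ht) (mem_univ x)
    have h1 : ContinuousOn (fun x => uncurry (u n) (t, x)) univ :=
      ((huc n).mono (prod_mono hIcc Subset.rfl)).comp (Continuous.prodMk_right t).continuousOn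
        hmaps
    have hu : Continuous (u n t) := continuousOn_univ.1 h1
    refine ⟨hu, ?_⟩
    show Continuous fun x => ⟪u n t x, timeDeriv ψ t x⟫ + ⟪u n t x, fderiv ℝ (ψ t) x (u n t x)⟫ +
      1 * ⟪u n t x, Δ (ψ t) x⟫
    exact ((hu.inner (cd t)).add (hu.inner ((cD t).clm_apply hu))).add
      (continuous_const.mul (hu.inner (cL t)))
  have hslice_int : ∀ n, ∀ t ∈ Ioo a₁ b₁, Integrable (fun x => Fn (u n) t x) volume := by
    intro n t ht
    refine (hslice_cont n t ht).2.integrable_of_hasCompactSupport ?_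
    exact HasCompactSupport.intro (isCompact_closedBall (0 : (EuclideanSpace ℝ (Fin 3))) 1) fun x hx =>
      hGzero (u n) t (Ioo_subset_Icc_self ht) x hx
  have hF_int : ∀ n, Integrable (fun t => ∫ x, Fn (u n) t x) (volume.restrict (Ioo a₁ b₁)) :=
    fun n => (integrable_prod_of_continuousOn (isCompact_closedBall (0 : (EuclideanSpace ℝ (Fin 3))) 1) (hGcont n)
      (hGzero (u n))).integral_prod_left
  -- Step 3: measurability of the deviations on `S`
  have hwm : ∀ n, AEStronglyMeasurable (w n) μS := by
    intro n
    have h1 : AEStronglyMeasurable (fun z : ℝ × (EuclideanSpace ℝ (Fin 3)) => u n z.1 z.2) μS :=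
      ((huc n).mono hSslab).aestronglyMeasurable hSm
    have h2 : AEStronglyMeasurable (fun z : ℝ × (EuclideanSpace ℝ (Fin 3)) => U z.2) μS := by
      rw [hμS, Measure.volume_eq_prod]
      exact hUm.comp_snd.restrict
    exact h1.sub h2
  have hUm2 : AEStronglyMeasurable (fun z : ℝ × (EuclideanSpace ℝ (Fin 3)) => U z.2) μS := by
    rw [hμS, Measure.volume_eq_prod]
    exact hUm.comp_snd.restrict
  -- Step 4: the pointwise bound by an integrand supported in `S`
  set g : ℕ → ℝ × (EuclideanSpace ℝ (Fin 3)) → ℝ≥0∞ := fun n z =>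
    ENNReal.ofReal (2 * M₀) * ‖w n z‖ₑ + ENNReal.ofReal (2 * M₀) * (‖U z.2‖ₑ * ‖w n z‖ₑ) +
      ENNReal.ofReal M * ‖w n z‖ₑ ^ 2 with hg
  have hgm : ∀ n, AEMeasurable (g n) μS := by
    intro n
    have h1 : AEMeasurable (fun z => ‖w n z‖ₑ) μS := (hwm n).enorm
    have h2 : AEMeasurable (fun z : ℝ × (EuclideanSpace ℝ (Fin 3)) => ‖U z.2‖ₑ) μS := hUm2.enorm
    exact (((h1.const_mul _).add ((h2.mul h1).const_mul _)).add ((h1.pow_const 2).const_mul _))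
  have hGm : ∀ n, AEMeasurable (S.indicator (g n)) (volume : Measure (ℝ × (EuclideanSpace ℝ (Fin 3)))) := fun n =>
    (aemeasurable_indicator_iff hSm).2 (hgm n)
  have hpt : ∀ n t x, ‖Fn (u n) t x - Fn (fun _ => U) t x‖ₑ ≤ S.indicator (g n) (t, x) := by
    intro n t x
    by_cases hz : (t, x) ∈ S
    · rw [indicator_of_mem hz]
      obtain ⟨h1, h2, h3⟩ := hMt t x
      have key := landauTail_enorm_veryWeakIntegrand_sub_le_defect (u n t x) (U x) _ _ _ M₀ M 1
        h1 h2 h3 (hMD t x)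
      have e1 : ENNReal.ofReal (M₀ * (1 + |(1 : ℝ)|)) = ENNReal.ofReal (2 * M₀) := by
        congr 1; norm_num; ring
      rw [e1] at key
      exact key
    · rw [indicator_of_notMem hz, hFn0_S (u n) t x hz, hFn0_S (fun _ => U) t x hz, sub_zero, enorm_zero]
  -- Step 5: for every `n`, `‖∫∫ F(U)‖ₑ ≤ ∫_S g n`
  have hbound : ∀ n, ‖∫ t in Ioo a₁ b₁, ∫ x, Fn (fun _ => U) t x‖ₑ ≤ ∫⁻ z in S, g n z := by
    intro n
    calc ‖∫ t in Ioo a₁ b₁, ∫ x, Fn (fun _ => U) t x‖ₑ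
        = ‖(∫ t in Ioo a₁ b₁, ∫ x, Fn (u n) t x) - ∫ t in Ioo a₁ b₁, ∫ x, Fn (fun _ => U) t x‖ₑ := by
          rw [hid' n, zero_sub, enorm_neg]
      _ = ‖∫ t in Ioo a₁ b₁, ((∫ x, Fn (u n) t x) - ∫ x, Fn (fun _ => U) t x)‖ₑ := by
          rw [integral_sub (hF_int n) hFU_int]
      _ ≤ ∫⁻ t in Ioo a₁ b₁, ‖(∫ x, Fn (u n) t x) - ∫ x, Fn (fun _ => U) t x‖ₑ :=
          enorm_integral_le_lintegral_enorm _
      _ ≤ ∫⁻ t in Ioo a₁ b₁, ∫⁻ x, S.indicator (g n) (t, x) := by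
          refine setLIntegral_mono' measurableSet_Ioo fun t ht => ?_
          rw [← integral_sub (hslice_int n t ht) (hintU t)]
          exact (enorm_integral_le_lintegral_enorm _).trans (lintegral_mono fun x => hpt n t x)
      _ ≤ ∫⁻ t, ∫⁻ x, S.indicator (g n) (t, x) := lintegral_mono' Measure.restrict_le_self le_rfl
      _ = ∫⁻ z, S.indicator (g n) z ∂((volume : Measure ℝ).prod (volume : Measure (EuclideanSpace ℝ (Fin 3)))) := by
          rw [lintegral_lintegral]
          rw [← Measure.volume_eq_prod]
          exact hGm n
      _ = ∫⁻ z in S, g n z := by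
          rw [← Measure.volume_eq_prod, lintegral_indicator hSm]
  -- Step 6: the three terms of `∫_S g n`
  set T₁ : ℕ → ℝ≥0∞ := fun n => ∫⁻ z in S, ‖w n z‖ₑ with hT₁
  set T₂ : ℕ → ℝ≥0∞ := fun n => ∫⁻ z in S, ‖U z.2‖ₑ * ‖w n z‖ₑ with hT₂
  have hsplit : ∀ n, ∫⁻ z in S, g n z =
      ENNReal.ofReal (2 * M₀) * T₁ n + ENNReal.ofReal (2 * M₀) * T₂ n + ENNReal.ofReal M * D n := by
    intro n
    have h1 : AEMeasurable (fun z => ‖w n z‖ₑ) μS := (hwm n).enorm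
    have h2 : AEMeasurable (fun z : ℝ × (EuclideanSpace ℝ (Fin 3)) => ‖U z.2‖ₑ) μS := hUm2.enorm
    have m1 : AEMeasurable (fun z => ENNReal.ofReal (2 * M₀) * ‖w n z‖ₑ +
        ENNReal.ofReal (2 * M₀) * (‖U z.2‖ₑ * ‖w n z‖ₑ)) μS :=
      (h1.const_mul _).add ((h2.mul h1).const_mul _)
    have m2 : AEMeasurable (fun z => ENNReal.ofReal (2 * M₀) * ‖w n z‖ₑ) μS := h1.const_mul _
    show ∫⁻ z, g n z ∂μS = _
    simp only [hg]
    rw [lintegral_add_left' m1, lintegral_add_left' m2,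
      lintegral_const_mul' _ _ ENNReal.ofReal_ne_top, lintegral_const_mul' _ _ ENNReal.ofReal_ne_top,
      lintegral_const_mul' _ _ ENNReal.ofReal_ne_top]
  -- Step 7: the linear terms tend to zero (Vitali at exponents `1` and `5/3`, Hölder against `U`)
  have hae0 : ∀ᵐ z ∂μS, Tendsto (fun n => w n z) atTop (𝓝 0) := by
    filter_upwards [hae] with z hz
    have h := hz.sub_const (U z.2)
    rwa [sub_self] at h
  have hbd' : ∃ C' : ℝ≥0, ∀ n, eLpNorm (w n) 2 μS ≤ C' := ⟨C, hbd⟩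
  have hT₁0 : Tendsto T₁ atTop (𝓝 0) := by
    have h := landauTail_tendsto_eLpNorm_of_eLpNorm_le μS w 0 1 2 le_rfl (by norm_num)
      ENNReal.ofNat_ne_top hwm hbd' hae0
    refine h.congr' (Eventually.of_forall fun n => ?_)
    rw [sub_zero, eLpNorm_one_eq_lintegral_enorm]
  set p₀ : ℝ≥0∞ := ENNReal.ofReal (5 / 3) with hp₀
  have hp₀1 : 1 ≤ p₀ := ENNReal.one_le_ofReal.2 (by norm_num)
  have hp₀2 : p₀ < 2 := by
    rw [hp₀, show (2 : ℝ≥0∞) = ENNReal.ofReal 2 by simp]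
    exact (ENNReal.ofReal_lt_ofReal_iff two_pos).2 (by norm_num)
  have hp₀0 : p₀ ≠ 0 := (zero_lt_one.trans_le hp₀1).ne'
  have hp₀top : p₀ ≠ ⊤ := ENNReal.ofReal_ne_top
  have hp₀r : p₀.toReal = 5 / 3 := ENNReal.toReal_ofReal (by norm_num)
  have hwp₀ : Tendsto (fun n => eLpNorm (w n) p₀ μS) atTop (𝓝 0) := by
    have h := landauTail_tendsto_eLpNorm_of_eLpNorm_le μS w 0 p₀ 2 hp₀1 hp₀2
      ENNReal.ofNat_ne_top hwm hbd' hae0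
    refine h.congr' (Eventually.of_forall fun n => ?_)
    rw [sub_zero]
  -- `U ∈ L^{5/2}(S)`
  set NU52 : ℝ≥0∞ := (∫⁻ z in S, ‖U z.2‖ₑ ^ (5 / 2 : ℝ)) ^ (1 / (5 / 2 : ℝ)) with hNU52
  have hU52' : ∫⁻ x in ball (0 : (EuclideanSpace ℝ (Fin 3))) 1, ‖U x‖ₑ ^ (5 / 2 : ℝ) < ⊤ := by
    have h0 : (5 / 2 : ℝ≥0∞) ≠ 0 := by simp
    have htop : (5 / 2 : ℝ≥0∞) ≠ ⊤ := by
      rw [Ne, ENNReal.div_eq_top]; simp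
    have hr : (5 / 2 : ℝ≥0∞).toReal = 5 / 2 := by rw [ENNReal.toReal_div]; simp
    have h := lintegral_rpow_enorm_lt_top_of_eLpNorm_lt_top h0 htop hU52
    rwa [hr] at h
  have hNU52top : NU52 ≠ ⊤ := by
    refine ENNReal.rpow_ne_top_of_nonneg (by norm_num) (lt_top_iff_ne_top.1 ?_)
    have hprod : ∫⁻ z in S, ‖U z.2‖ₑ ^ (5 / 2 : ℝ) =
        volume (Ioo s₁ s₂) * ∫⁻ x in ball (0 : (EuclideanSpace ℝ (Fin 3))) ρ, ‖U x‖ₑ ^ (5 / 2 : ℝ) := by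
      rw [hSdef, Measure.volume_eq_prod, ← Measure.prod_restrict]
      have e : (fun z : ℝ × (EuclideanSpace ℝ (Fin 3)) => ‖U z.2‖ₑ ^ (5 / 2 : ℝ)) =
          fun z => (fun _ : ℝ => (1 : ℝ≥0∞)) z.1 * (fun x : (EuclideanSpace ℝ (Fin 3)) => ‖U x‖ₑ ^ (5 / 2 : ℝ)) z.2 := by
        funext z; simp only [one_mul]
      rw [e, lintegral_prod_mul aemeasurable_const (hUm.restrict.enorm.pow_const _), lintegral_const,
        Measure.restrict_apply_univ, one_mul]
    rw [hprod, Real.volume_Ioo]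
    refine ENNReal.mul_lt_top ENNReal.ofReal_lt_top ?_
    exact lt_of_le_of_lt (lintegral_mono_set (ball_subset_ball hρ1)) hU52'
  have hT₂le : ∀ n, T₂ n ≤ NU52 * eLpNorm (w n) p₀ μS := by
    intro n
    have hpq : Real.HolderConjugate (5 / 2) (5 / 3) := by
      rw [Real.holderConjugate_iff]; norm_num
    have h := ENNReal.lintegral_mul_le_Lp_mul_Lq μS hpq hUm2.enorm (hwm n).enorm
    rw [eLpNorm_eq_lintegral_rpow_enorm_toReal hp₀0 hp₀top, hp₀r]
    simpa only [Pi.mul_apply] using h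
  set A : ℕ → ℝ≥0∞ := fun n => ENNReal.ofReal (2 * M₀) * T₁ n +
    ENNReal.ofReal (2 * M₀) * (NU52 * eLpNorm (w n) p₀ μS) with hA
  have hA0 : Tendsto A atTop (𝓝 0) := by
    have h1 : Tendsto (fun n => ENNReal.ofReal (2 * M₀) * T₁ n) atTop (𝓝 0) := by
      have h := ENNReal.Tendsto.const_mul (a := ENNReal.ofReal (2 * M₀)) hT₁0 (Or.inr ENNReal.ofReal_ne_top)
      rwa [mul_zero] at h
    have h2 : Tendsto (fun n => NU52 * eLpNorm (w n) p₀ μS) atTop (𝓝 0) := by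
      have h := ENNReal.Tendsto.const_mul (a := NU52) hwp₀ (Or.inr hNU52top)
      rwa [mul_zero] at h
    have h3 : Tendsto (fun n => ENNReal.ofReal (2 * M₀) * (NU52 * eLpNorm (w n) p₀ μS)) atTop (𝓝 0) := by
      have h := ENNReal.Tendsto.const_mul (a := ENNReal.ofReal (2 * M₀)) h2 (Or.inr ENNReal.ofReal_ne_top)
      rwa [mul_zero] at h
    have h := h1.add h3
    rw [add_zero] at h
    exact h
  have hmain : ∀ n, ‖∫ t in Ioo a₁ b₁, ∫ x, Fn (fun _ => U) t x‖ₑ ≤ A n + ENNReal.ofReal M * D n := by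
    intro n
    refine (hbound n).trans ?_
    rw [hsplit n]
    have h := hT₂le n
    simp only [hA]
    gcongr
  -- Step 8: pass to the limit inferior
  set X : ℝ≥0∞ := ‖∫ t in Ioo a₁ b₁, ∫ x, Fn (fun _ => U) t x‖ₑ with hX
  refine ENNReal.le_of_forall_pos_le_add fun ε hε _ => ?_
  have hε' : (0 : ℝ≥0∞) < ε := by exact_mod_cast hε
  have hev : ∀ᶠ n in atTop, X ≤ ENNReal.ofReal M * D n + ε := by
    filter_upwards [hA0.eventually (gt_mem_nhds hε')] with n hn
    calc X ≤ A n + ENNReal.ofReal M * D n := hmain n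
      _ ≤ ε + ENNReal.ofReal M * D n := by gcongr
      _ = ENNReal.ofReal M * D n + ε := add_comm _ _
  have hle : X ≤ liminf (fun n => ENNReal.ofReal M * D n + (ε : ℝ≥0∞)) atTop := le_liminf_of_le (h := hev)
  have hmono : Monotone fun y : ℝ≥0∞ => ENNReal.ofReal M * y + ε := fun a b hab => by
    dsimp only; gcongr
  have hcont : Continuous fun y : ℝ≥0∞ => ENNReal.ofReal M * y + ε :=
    (ENNReal.continuous_const_mul ENNReal.ofReal_ne_top).add continuous_const
  have hmap : liminf (fun n => ENNReal.ofReal M * D n + (ε : ℝ≥0∞)) atTop =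
      ENNReal.ofReal M * liminf D atTop + ε :=
    (hmono.map_liminf_of_continuousAt D hcont.continuousAt).symm
  rw [hmap] at hle
  exact hle

end Summit.NavierStokesRegularity.NavierStokesRegularity.Theorems

end
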